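import Mathlib
import Summits.MatrixMultiplication.MatrixMultiplication.Theorems.SnSubsetDichotomyPolynomialSlackAtomWins
import Summits.MatrixMultiplication.MatrixMultiplication.Theorems.SnSubsetDichotomyPolynomialSlackAtomBasicFacts
import Summits.MatrixMultiplication.MatrixMultiplication.Theorems.SnSubsetDichotomyPolynomialSlackAtomBasicFactsMasked
import Summits.MatrixMultiplication.MatrixMultiplication.Theorems.SnSubsetDichotomyPolynomialSlackStubSplit
import Summits.MatrixMultiplication.MatrixMultiplication.Theorems.SnSubsetDichotomyPolynomialSlackPositionRates

/-!
# No-win consequences of the atoms with a column mask and the far area (3/4 step)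

Crux `Summit.MatrixMultiplication.MatrixMultiplication.Theses.SnSubsetDichotomy.PolynomialSlack`
(item `stmt-MatrixMultiplication-8306`), level-one programme, line transport-split-hull (lead c10),
stubs `atom_noWin_facts_masked` (HA1-m), `atom_farArea_penalty_masked` (HA1-far) and
`incl_rate_bounds_masked` (HA1b-m).

MASKED and FAR copies of c9's `atom_noWin_facts` and `incl_rate_bounds` (`…PositionRates`).  At a
hub position `k` of `U` the T-level blocks `J_a = {j : θB ≤ dB j k, ⌊log₂(1/dB j k)⌋₊ = a}` are
unchanged, while the S-level blocks are the dyadic level blocks of the heavy row `dC(k,·)` with a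
set `Qm` of S-positions removed, `I_b = {i ∉ Qm : θC ≤ dC k i, ⌊log₂(1/dC k i)⌋₊ = b}`.  A masked
block is still a flat sub-block of a level block (`γ ≤ dC ≤ 2γ`, `15/16 γ ≤ pC ≤ 4 · 15/16 γ` on
it, so `heavyBlock_sums_cmp` of `…AtomBasicFactsMasked` compares its kept and plain masses), and
the win lemmas of `…AtomWins` (`hits_gt_of_noWin_hubArea`, `hubMass_lt_of_noWin_depleted`,
`card_sq_gt_of_noWin_T/S`, `area_max_le_of_depleted`) are stated for ARBITRARY flat blocks, so the
proofs of `atom_noWin_facts` go through verbatim.  The win budget `hW` now carries a fourth summand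
`20 (1+M) A₁² B/(h₁² n)`, the hub-of-area win at the larger area `A₁`; since all four summands are
nonnegative each of them is `< N = |S||T||U|` under the no-win hypothesis `W < N`.

* `subLevelAtom_penalty_of_noWin_hubArea` — the common core of conclusion (5) and of the far-area
  penalty: for sub-blocks `J ⊆ J_a`, `I ⊆ I_b` of hub mass `≥ h₁` and area `max(|J|,1)·max(|I|,1) ≤ A`,
  no hub win at area `A` forces `(n-1)(σρ/n - Ψ) ≤ -(M/2)σρ`;
* `atom_noWin_facts_masked` — conclusions (1)–(5) of `atom_noWin_facts` for the masked blocks;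
* `atom_farArea_penalty_masked` — the same penalty for atoms of area `≤ A₁` (fourth summand);
* `incl_rate_bounds_masked` — the rate box `0.245 log n ≤ log x a, log y b ≤ 0.755 log n` of the
  levels of substantial depleted pairs ((1)–(3) and the scalar lemma `rate_box`).
-/

namespace Summit.MatrixMultiplication.MatrixMultiplication.Theorems.PolynomialSlack

open scoped BigOperators
open Literature.Combinatorics.Additive (TripleProductProperty)

set_option linter.dupNamespace false

/-! ## The hub penalty at a general area -/

/-- **No hub win at area `A` ⇒ strong anti-depletion (sub-level form).** At a hub position `k`,
let `J` be a sub-block of the T-level block `a` of `dB(·,k)` and `I` a sub-block of the S-level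
block `b` of `dC(k,·)` (thresholds `θB, θC ≥ 16/n`, kept entries `pB, pC`), with kept masses
`σ = Σ_J pB`, `ρ = Σ_I pC`, kept atom mass `Ψ = Σ_{I×J} dA pB pC` and sizes `x = max(|J|,1)`,
`y = max(|I|,1)`.  If the atom has hub mass `≥ h₁ > 0`, area `x · y ≤ A`, and the volume
`|S||T||U|` exceeds the hub win bound `20(1+M)A²B/(h₁²n)` (`M ≥ 0`), then
`(n-1)(σρ/n - Ψ) ≤ -(M/2) σ ρ`.  Proof: both blocks are flat (`kept_level_flat`:
`β₀ ≤ dB ≤ 2β₀`, `γ₀ ≤ dC ≤ 2γ₀`, `β₀, γ₀ ≥ 16/n`) and `pB = dB - 1/n`, `pC = dC - 1/n` there, so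
`hits_gt_of_noWin_hubArea` gives `(1+M)σρ/n < Ψ`; multiply by `n - 1 ≥ n/2`. -/
theorem subLevelAtom_penalty_of_noWin_hubArea {n : ℕ} (hn : 2 ≤ n) (B : ℕ)
    (hB : ∀ S' T' U' : Finset (Equiv.Perm (Fin (n - 1))), TripleProductProperty S' T' U' →
      S'.card * T'.card * U'.card ≤ B)
    {S T U : Finset (Equiv.Perm (Fin n))} (hTPP : TripleProductProperty S T U) (hS0 : S.Nonempty)
    (hT0 : T.Nonempty) (hU0 : U.Nonempty) (dA dB dC pB pC : Fin n → Fin n → ℝ)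
    (hdA : ∀ i j, dA i j =
      (((S ×ˢ T).filter fun st => st.2 j = st.1 i).card : ℝ) / (S.card * T.card : ℕ))
    (hdB : ∀ j k, dB j k =
      (((T ×ˢ U).filter fun tu => tu.2 k = tu.1 j).card : ℝ) / (T.card * U.card : ℕ))
    (hdC : ∀ k i, dC k i =
      (((U ×ˢ S).filter fun us => us.2 i = us.1 k).card : ℝ) / (U.card * S.card : ℕ))
    (θB θC : ℝ) (hθB : 16 / (n : ℝ) ≤ θB) (hθC : 16 / (n : ℝ) ≤ θC)
    (hpB : ∀ j k, pB j k = if θB ≤ dB j k then dB j k - 1 / n else 0)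
    (hpC : ∀ k i, pC k i = if θC ≤ dC k i then dC k i - 1 / n else 0)
    (M h₁ A : ℝ) (hM0 : 0 ≤ M) (hh₁ : 0 < h₁) (k : Fin n) (J I : Finset (Fin n)) (a b : ℕ)
    (hJ : ∀ j ∈ J, θB ≤ dB j k ∧ ⌊Real.logb 2 (1 / dB j k)⌋₊ = a)
    (hI : ∀ i ∈ I, θC ≤ dC k i ∧ ⌊Real.logb 2 (1 / dC k i)⌋₊ = b)
    (σa ρb Ψab xa yb : ℝ) (hσ : σa = ∑ j ∈ J, pB j k) (hx : xa = max (J.card : ℝ) 1)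
    (hρ : ρb = ∑ i ∈ I, pC k i) (hy : yb = max (I.card : ℝ) 1)
    (hΨ : Ψab = ∑ i ∈ I, ∑ j ∈ J, dA i j * pB j k * pC k i)
    (hhub : h₁ ≤ ∑ v : Fin n, ((U.filter fun u => u k = v).card : ℝ) / U.card *
      ((((T.filter fun t => t⁻¹ v ∈ J).card : ℝ) / T.card) *
        (((S.filter fun s => s⁻¹ v ∈ I).card : ℝ) / S.card)))
    (harea : xa * yb ≤ A)
    (hN : 20 * (1 + M) * A ^ 2 * B / (h₁ ^ 2 * n) < ((S.card * T.card * U.card : ℕ) : ℝ)) :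
    ((n : ℝ) - 1) * (σa * ρb / n - Ψab) ≤ -(M / 2) * σa * ρb := by
  have hn0 : 0 < n := by omega
  have hnR : (0 : ℝ) < n := by exact_mod_cast hn0
  have hn2 : (2 : ℝ) ≤ n := by exact_mod_cast hn
  -- flatness of the two sub-level blocks
  have hdB1 : ∀ j, dB j k ≤ 1 := fun j => by rw [hdB]; exact pairDensity_le_one T U _
  have hdC1 : ∀ i, dC k i ≤ 1 := fun i => by rw [hdC]; exact pairDensity_le_one U S _
  set β₀ := max ((1 / 2 : ℝ) ^ (a + 1)) θB with hβ₀
  set γ₀ := max ((1 / 2 : ℝ) ^ (b + 1)) θC with hγ₀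
  have hflJ : ∀ j ∈ J, θB ≤ dB j k ∧ pB j k = dB j k - 1 / n ∧ (β₀ ≤ dB j k ∧ dB j k ≤ 2 * β₀) ∧
      (15 / 16 * β₀ ≤ pB j k ∧ pB j k ≤ 4 * (15 / 16 * β₀)) := fun j hj =>
    kept_level_flat hn0 (fun j => dB j k) (fun j => pB j k) θB hθB (fun j => hpB j k) hdB1 a j
      (Finset.mem_filter.2 ⟨Finset.mem_univ _, hJ j hj⟩)
  have hflI : ∀ i ∈ I, θC ≤ dC k i ∧ pC k i = dC k i - 1 / n ∧ (γ₀ ≤ dC k i ∧ dC k i ≤ 2 * γ₀) ∧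
      (15 / 16 * γ₀ ≤ pC k i ∧ pC k i ≤ 4 * (15 / 16 * γ₀)) := fun i hi =>
    kept_level_flat hn0 (fun i => dC k i) (fun i => pC k i) θC hθC (fun i => hpC k i) hdC1 b i
      (Finset.mem_filter.2 ⟨Finset.mem_univ _, hI i hi⟩)
  have hβ : 16 / (n : ℝ) ≤ β₀ := hθB.trans (le_max_right _ _)
  have hγ : 16 / (n : ℝ) ≤ γ₀ := hθC.trans (le_max_right _ _)
  have hβp : 0 < β₀ := lt_of_lt_of_le (by positivity) hβ
  have hγp : 0 < γ₀ := lt_of_lt_of_le (by positivity) hγ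
  -- the block sums in the `d - 1/n` form
  have hsumJ : ∑ j ∈ J, (dB j k - 1 / n) = σa := by
    rw [hσ]
    exact Finset.sum_congr rfl fun j hj => ((hflJ j hj).2.1).symm
  have hsumI : ∑ i ∈ I, (dC k i - 1 / n) = ρb := by
    rw [hρ]
    exact Finset.sum_congr rfl fun i hi => ((hflI i hi).2.1).symm
  have hsumΨ : ∑ i ∈ I, ∑ j ∈ J, dA i j * (dB j k - 1 / n) * (dC k i - 1 / n) = Ψab := by
    rw [hΨ]
    refine Finset.sum_congr rfl fun i hi => Finset.sum_congr rfl fun j hj => ?_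
    rw [(hflJ j hj).2.1, (hflI i hi).2.1]
  -- nonnegativity of the kept masses
  have hσ0 : 0 ≤ σa := by
    rw [hσ]
    exact Finset.sum_nonneg fun j hj => le_trans (by positivity) (hflJ j hj).2.2.2.1
  have hρ0 : 0 ≤ ρb := by
    rw [hρ]
    exact Finset.sum_nonneg fun i hi => le_trans (by positivity) (hflI i hi).2.2.2.1
  -- the area in the `card` form
  have hx1 : (J.card : ℝ) ≤ xa := by rw [hx]; exact le_max_left _ _
  have hy1 : (I.card : ℝ) ≤ yb := by rw [hy]; exact le_max_left _ _
  have harea' : (I.card : ℝ) * J.card ≤ A :=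
    calc (I.card : ℝ) * J.card ≤ yb * xa :=
          mul_le_mul hy1 hx1 (Nat.cast_nonneg _) ((Nat.cast_nonneg _).trans hy1)
      _ = xa * yb := mul_comm _ _
      _ ≤ A := harea
  -- no hub win at area `A`
  have hhit := hits_gt_of_noWin_hubArea hn B hB hTPP hS0 hT0 hU0 dA dB dC hdA hdB hdC k J I β₀ γ₀
    M h₁ A hβ hγ hM0 hh₁ (fun j hj => (hflJ j hj).2.2.1) (fun i hi => (hflI i hi).2.2.1) hhub
    harea' hN
  rw [hsumJ, hsumI, hsumΨ] at hhit
  -- multiply `σρ/n - Ψ < -Mσρ/n` by `n - 1 ≥ n/2`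
  have hsr : 0 ≤ σa * ρb := mul_nonneg hσ0 hρ0
  have hq : (1 + M) * (σa * ρb) / n = σa * ρb / n + M * (σa * ρb) / n := by ring
  have hn1 : (0 : ℝ) ≤ (n : ℝ) - 1 := by linarith
  have h2 : ((n : ℝ) - 1) * (σa * ρb / n - Ψab) ≤ ((n : ℝ) - 1) * (-(M * (σa * ρb) / n)) :=
    mul_le_mul_of_nonneg_left (by linarith) hn1
  have h3 : (1 / 2 : ℝ) ≤ ((n : ℝ) - 1) / n := by
    rw [le_div_iff₀ hnR]
    linarith
  have h4 : M * (σa * ρb) * (1 / 2) ≤ M * (σa * ρb) * (((n : ℝ) - 1) / n) :=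
    mul_le_mul_of_nonneg_left h3 (mul_nonneg hM0 hsr)
  have h5 : ((n : ℝ) - 1) * (-(M * (σa * ρb) / n)) = -(M * (σa * ρb) * (((n : ℝ) - 1) / n)) := by
    ring
  have h6 : -(M / 2) * σa * ρb = -(M * (σa * ρb) * (1 / 2)) := by ring
  rw [h6]
  linarith

/-! ## The stubs -/

/-- **No-win facts, masked (HA1-m).** As `atom_noWin_facts` for the masked S-blocks, under the win budget with the extra `A₁`-term: (1)-(2) no pinned-block wins, (3) depleted atoms have area `≤ A₀`, (4) depleted atoms have hub mass `< h₁`, (5) small-area (`≤ A₀`) hub atoms are strongly anti-depleted. [folklore] -/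
theorem atom_noWin_facts_masked {n : ℕ} (hn : 2 ≤ n) (B : ℕ) (hB : ∀ S' T' U' : Finset (Equiv.Perm (Fin (n - 1))), TripleProductProperty S' T' U' → S'.card * T'.card * U'.card ≤ B) {S T U : Finset (Equiv.Perm (Fin n))} (hTPP : TripleProductProperty S T U) (hS0 : S.Nonempty) (hT0 : T.Nonempty) (hU0 : U.Nonempty) (dA dB dC pB pC : Fin n → Fin n → ℝ) (hdA : ∀ i j, dA i j = (((S ×ˢ T).filter fun st => st.2 j = st.1 i).card : ℝ) / (S.card * T.card : ℕ)) (hdB : ∀ j k, dB j k = (((T ×ˢ U).filter fun tu => tu.2 k = tu.1 j).card : ℝ) / (T.card * U.card : ℕ)) (hdC : ∀ k i, dC k i = (((U ×ˢ S).filter fun us => us.2 i = us.1 k).card : ℝ) / (U.card * S.card : ℕ)) (θB θC : ℝ) (hθB : 16 / (n : ℝ) ≤ θB) (hθC : 16 / (n : ℝ) ≤ θC) (hpB : ∀ j k, pB j k = if θB ≤ dB j k then dB j k - 1 / n else 0) (hpC : ∀ k i, pC k i = if θC ≤ dC k i then dC k i - 1 / n else 0) (ε₁ ε₂ h₁ M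 A₀ P W A₁ : ℝ) (hε₁ : 0 < ε₁) (hε₂ : 0 < ε₂) (hε₂1 : ε₂ ≤ 1) (hh₁ : 0 < h₁) (hP0 : 0 ≤ P) (hM : 56 * (((⌊Real.logb 2 ((n : ℝ) ^ 2)⌋₊ + 1 : ℕ) : ℝ) * ((⌊Real.logb 2 ((n : ℝ) ^ 2)⌋₊ + 1 : ℕ) : ℝ)) ≤ M) (hA₀ : 5000 * n * (1 + Real.log n) * Real.log (4 * ((n.factorial : ℝ) / (S.card * T.card : ℕ)) / ε₂) / ε₂ ^ 2 ≤ A₀) (hA₀n : (n : ℝ) ≤ A₀) (hPlow : A₀ ^ 2 * (n : ℝ) ^ (-(151 / 100 : ℝ)) ≤ P * ε₁ ^ 2) (hW : 10 ^ 7 * (1 + Real.log n) ^ 2 * (Real.log (4 * ((n.factorial : ℝ) / (S.card * T.card : ℕ)) / ε₂)) ^ 2 * n * B / (ε₂ ^ 4 * h₁ ^ 2) + 20 * (1 + M) * A₀ ^ 2 * B / (h₁ ^ 2 * n) + n * P * B + 20 * (1 + M) * A₁ ^ 2 * B / (h₁ ^ 2 * n) ≤ W) (hN : W < ((S.card * T.card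 * U.card : ℕ) : ℝ)) (k : Fin n) (Qm : Finset (Fin n)) (σ σ' x ρ ρ' y : Fin (⌊Real.logb 2 ((n : ℝ) ^ 2)⌋₊ + 1) → ℝ) (hσ : ∀ a, σ a = ∑ j ∈ Finset.univ.filter (fun j => θB ≤ dB j k ∧ ⌊Real.logb 2 (1 / dB j k)⌋₊ = a.val), pB j k) (hσ' : ∀ a, σ' a = ∑ j ∈ Finset.univ.filter (fun j => θB ≤ dB j k ∧ ⌊Real.logb 2 (1 / dB j k)⌋₊ = a.val), dB j k) (hx : ∀ a, x a = max (((Finset.univ.filter (fun j => θB ≤ dB j k ∧ ⌊Real.logb 2 (1 / dB j k)⌋₊ = a.val)).card : ℝ)) 1) (hρ : ∀ b, ρ b = ∑ i ∈ Finset.univ.filter (fun i => i ∉ Qm ∧ θC ≤ dC k i ∧ ⌊Real.logb 2 (1 / dC k i)⌋₊ = b.val), pC k i) (hρ' : ∀ b, ρ' b = ∑ i ∈ Finset.univ.filter (fun i => i ∉ Qm ∧ θC ≤ dC k i ∧ ⌊Real.logb 2 (1 / dC k i)⌋₊ = b.val), dC k i) (hy : ∀ b, y b = max (((Finset.univ.filter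 (fun i => i ∉ Qm ∧ θC ≤ dC k i ∧ ⌊Real.logb 2 (1 / dC k i)⌋₊ = b.val)).card : ℝ)) 1) (Ψ : Fin (⌊Real.logb 2 ((n : ℝ) ^ 2)⌋₊ + 1) → Fin (⌊Real.logb 2 ((n : ℝ) ^ 2)⌋₊ + 1) → ℝ) (hΨ : ∀ a b, Ψ a b = ∑ i ∈ Finset.univ.filter (fun i => i ∉ Qm ∧ θC ≤ dC k i ∧ ⌊Real.logb 2 (1 / dC k i)⌋₊ = b.val), ∑ j ∈ Finset.univ.filter (fun j => θB ≤ dB j k ∧ ⌊Real.logb 2 (1 / dB j k)⌋₊ = a.val), dA i j * pB j k * pC k i) (a b : Fin (⌊Real.logb 2 ((n : ℝ) ^ 2)⌋₊ + 1)) : (ε₁ ≤ σ a → A₀ ^ 2 * (n : ℝ) ^ (-(151 / 100 : ℝ)) < x a ^ 2) ∧ (ε₁ ≤ ρ b → A₀ ^ 2 * (n : ℝ) ^ (-(151 / 100 : ℝ)) < y b ^ 2) ∧ (Ψ a b ≤ (1 - ε₂) * (σ a * ρ b) / n → x a * y b ≤ A₀) ∧ (Ψ a b ≤ (1 - ε₂)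 * (σ a * ρ b) / n → ∑ v : Fin n, ((U.filter fun u => u k = v).card : ℝ) / U.card * ((((T.filter fun t => t⁻¹ v ∈ Finset.univ.filter (fun j => θB ≤ dB j k ∧ ⌊Real.logb 2 (1 / dB j k)⌋₊ = a.val)).card : ℝ) / T.card) * (((S.filter fun s => s⁻¹ v ∈ Finset.univ.filter (fun i => i ∉ Qm ∧ θC ≤ dC k i ∧ ⌊Real.logb 2 (1 / dC k i)⌋₊ = b.val)).card : ℝ) / S.card)) < h₁) ∧ (h₁ ≤ ∑ v : Fin n, ((U.filter fun u => u k = v).card : ℝ) / U.card * ((((T.filter fun t => t⁻¹ v ∈ Finset.univ.filter (fun j => θB ≤ dB j k ∧ ⌊Real.logb 2 (1 / dB j k)⌋₊ = a.val)).card : ℝ) / T.card) * (((S.filter fun s => s⁻¹ v ∈ Finset.univ.filter (fun i => i ∉ Qm ∧ θC ≤ dC k i ∧ ⌊Real.logb 2 (1 / dC k i)⌋₊ = b.val)).card : ℝ) / S.card)) → x a * y b ≤ A₀ → ((n : ℝ) - 1) * (σ a * ρ b / n - Ψ a b) ≤ -(M / 2) * σ a * ρ b) := by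
  have hn0 : 0 < n := by omega
  have hnR : (0 : ℝ) < n := by exact_mod_cast hn0
  -- the block data at `(a, b)`
  have hσa := hσ a
  have hσ'a := hσ' a
  have hxa := hx a
  have hρb := hρ b
  have hρ'b := hρ' b
  have hyb := hy b
  have hΨab := hΨ a b
  set J := Finset.univ.filter (fun j => θB ≤ dB j k ∧ ⌊Real.logb 2 (1 / dB j k)⌋₊ = a.val)
    with hJ
  set I := Finset.univ.filter
    (fun i => i ∉ Qm ∧ θC ≤ dC k i ∧ ⌊Real.logb 2 (1 / dC k i)⌋₊ = b.val) with hI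
  have hJl : ∀ j ∈ J, θB ≤ dB j k ∧ ⌊Real.logb 2 (1 / dB j k)⌋₊ = a.val := fun j hj =>
    (Finset.mem_filter.1 hj).2
  have hIl : ∀ i ∈ I, θC ≤ dC k i ∧ ⌊Real.logb 2 (1 / dC k i)⌋₊ = b.val := fun i hi =>
    (Finset.mem_filter.1 hi).2.2
  -- kept masses versus block masses
  have hσf : 0 ≤ σ a ∧ σ a ≤ σ' a ∧ 15 / 16 * σ' a ≤ σ a := by
    rw [hσa, hσ'a]
    exact heavyBlock_sums_cmp hn0 (fun j => dB j k) (fun j => pB j k) θB hθB (fun j => hpB j k) J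
      fun j hj => (hJl j hj).1
  have hρf : 0 ≤ ρ b ∧ ρ b ≤ ρ' b ∧ 15 / 16 * ρ' b ≤ ρ b := by
    rw [hρb, hρ'b]
    exact heavyBlock_sums_cmp hn0 (fun i => dC k i) (fun i => pC k i) θC hθC (fun i => hpC k i) I
      fun i hi => (hIl i hi).1
  -- flatness of the level blocks
  have hdB1 : ∀ j, dB j k ≤ 1 := fun j => by rw [hdB]; exact pairDensity_le_one T U _
  have hdC1 : ∀ i, dC k i ≤ 1 := fun i => by rw [hdC]; exact pairDensity_le_one U S _
  set β₀ := max ((1 / 2 : ℝ) ^ (a.val + 1)) θB with hβ₀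
  set γ₀ := max ((1 / 2 : ℝ) ^ (b.val + 1)) θC with hγ₀
  have hflJ : ∀ j ∈ J, θB ≤ dB j k ∧ pB j k = dB j k - 1 / n ∧ (β₀ ≤ dB j k ∧ dB j k ≤ 2 * β₀) ∧
      (15 / 16 * β₀ ≤ pB j k ∧ pB j k ≤ 4 * (15 / 16 * β₀)) := fun j hj =>
    kept_level_flat hn0 (fun j => dB j k) (fun j => pB j k) θB hθB (fun j => hpB j k) hdB1 a.val j
      (Finset.mem_filter.2 ⟨Finset.mem_univ _, hJl j hj⟩)
  have hflI : ∀ i ∈ I, θC ≤ dC k i ∧ pC k i = dC k i - 1 / n ∧ (γ₀ ≤ dC k i ∧ dC k i ≤ 2 * γ₀) ∧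
      (15 / 16 * γ₀ ≤ pC k i ∧ pC k i ≤ 4 * (15 / 16 * γ₀)) := fun i hi =>
    kept_level_flat hn0 (fun i => dC k i) (fun i => pC k i) θC hθC (fun i => hpC k i) hdC1 b.val i
      (Finset.mem_filter.2 ⟨Finset.mem_univ _, hIl i hi⟩)
  have hβ : 16 / (n : ℝ) ≤ β₀ := hθB.trans (le_max_right _ _)
  have hγ : 16 / (n : ℝ) ≤ γ₀ := hθC.trans (le_max_right _ _)
  have hβp : 0 < β₀ := lt_of_lt_of_le (by positivity) hβ
  have hγp : 0 < γ₀ := lt_of_lt_of_le (by positivity) hγ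
  -- the block sums in the `d - 1/n` form
  have hsumJ : ∑ j ∈ J, (dB j k - 1 / n) = σ a := by
    rw [hσa]
    exact Finset.sum_congr rfl fun j hj => ((hflJ j hj).2.1).symm
  have hsumI : ∑ i ∈ I, (dC k i - 1 / n) = ρ b := by
    rw [hρb]
    exact Finset.sum_congr rfl fun i hi => ((hflI i hi).2.1).symm
  have hsumΨ : ∑ i ∈ I, ∑ j ∈ J, dA i j * (dB j k - 1 / n) * (dC k i - 1 / n) = Ψ a b := by
    rw [hΨab]
    refine Finset.sum_congr rfl fun i hi => Finset.sum_congr rfl fun j hj => ?_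
    rw [(hflJ j hj).2.1, (hflI i hi).2.1]
  -- the four win bounds are nonnegative, hence each is exceeded by `N`
  have hM0 : 0 ≤ M := le_trans (by positivity) hM
  have hW1 : 0 ≤ 10 ^ 7 * (1 + Real.log n) ^ 2 *
      (Real.log (4 * ((n.factorial : ℝ) / (S.card * T.card : ℕ)) / ε₂)) ^ 2 * n * B /
        (ε₂ ^ 4 * h₁ ^ 2) := by positivity
  have h1M : 0 ≤ 1 + M := by linarith
  have hW2 : 0 ≤ 20 * (1 + M) * A₀ ^ 2 * B / (h₁ ^ 2 * n) := by positivity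
  have hW3 : 0 ≤ (n : ℝ) * P * B := by positivity
  have hW4 : 0 ≤ 20 * (1 + M) * A₁ ^ 2 * B / (h₁ ^ 2 * n) := by positivity
  have hN1 : 10 ^ 7 * (1 + Real.log n) ^ 2 *
      (Real.log (4 * ((n.factorial : ℝ) / (S.card * T.card : ℕ)) / ε₂)) ^ 2 * n * B /
        (ε₂ ^ 4 * h₁ ^ 2) < ((S.card * T.card * U.card : ℕ) : ℝ) := by linarith
  have hN2 : 20 * (1 + M) * A₀ ^ 2 * B / (h₁ ^ 2 * n) < ((S.card * T.card * U.card : ℕ) : ℝ) := by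
    linarith
  have hN3 : (n : ℝ) * P * B < ((S.card * T.card * U.card : ℕ) : ℝ) := by linarith
  have hx1 : (J.card : ℝ) ≤ x a := by rw [hxa]; exact le_max_left _ _
  have hy1 : (I.card : ℝ) ≤ y b := by rw [hyb]; exact le_max_left _ _
  refine ⟨fun ha => ?_, fun hb => ?_, fun hdep => ?_, fun hdep => ?_, fun hhub harea => ?_⟩
  · -- (1) no pinned-block win for `T`
    have hσ'pos : 0 < σ' a := by linarith [hσf.2.1]
    have hmass : σ' a ≤ ∑ v : Fin n, ((U.filter fun u => u k = v).card : ℝ) / U.card *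
        (((T.filter fun t => t⁻¹ v ∈ J).card : ℝ) / T.card) := by
      rw [hσ'a, ← blockMass_eq_sum_mu T U hT0 hU0 J k]
      exact le_of_eq (Finset.sum_congr rfl fun j _ => hdB j k)
    have hcard := card_sq_gt_of_noWin_T B hB hTPP hT0 hU0 k J (σ' a) P hσ'pos hP0 hmass hN3
    have h1 : P * ε₁ ^ 2 ≤ P * σ' a ^ 2 :=
      mul_le_mul_of_nonneg_left (pow_le_pow_left₀ hε₁.le (by linarith [hσf.2.1]) 2) hP0
    have h2 : (J.card : ℝ) ^ 2 ≤ x a ^ 2 := pow_le_pow_left₀ (Nat.cast_nonneg _) hx1 2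
    linarith
  · -- (2) no pinned-block win for `S`
    have hρ'pos : 0 < ρ' b := by linarith [hρf.2.1]
    have hmass : ρ' b ≤ ∑ v : Fin n, ((U.filter fun u => u k = v).card : ℝ) / U.card *
        (((S.filter fun s => s⁻¹ v ∈ I).card : ℝ) / S.card) := by
      rw [hρ'b, ← blockMassRow_eq_sum_mu U S I k]
      exact le_of_eq (Finset.sum_congr rfl fun i _ => hdC k i)
    have hcard := card_sq_gt_of_noWin_S B hB hTPP hS0 hU0 k I (ρ' b) P hρ'pos hP0 hmass hN3
    have h1 : P * ε₁ ^ 2 ≤ P * ρ' b ^ 2 :=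
      mul_le_mul_of_nonneg_left (pow_le_pow_left₀ hε₁.le (by linarith [hρf.2.1]) 2) hP0
    have h2 : (I.card : ℝ) ^ 2 ≤ y b ^ 2 := pow_le_pow_left₀ (Nat.cast_nonneg _) hy1 2
    linarith
  · -- (3) depleted atoms have small area
    rw [hxa, hyb]
    have hdep' : ∑ i ∈ I, ∑ j ∈ J, dA i j * pB j k * pC k i ≤
        (1 - ε₂) * ((∑ j ∈ J, pB j k) * (∑ i ∈ I, pC k i)) / n := by
      rw [← hσa, ← hρb, ← hΨab]
      exact hdep
    exact area_max_le_of_depleted hn S T hS0 hT0 (injOn_quot_first hTPP hU0) dA hdA I J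
      (fun j => pB j k) (fun i => pC k i) (15 / 16 * β₀) (15 / 16 * γ₀) ε₂ A₀ (by positivity)
      (by positivity) hε₂ hε₂1 (fun j hj => (hflJ j hj).2.2.2) (fun i hi => (hflI i hi).2.2.2)
      hdep' hA₀ hA₀n
  · -- (4) no depleted-atom win
    have hdep' : ∑ i ∈ I, ∑ j ∈ J, dA i j * (dB j k - 1 / n) * (dC k i - 1 / n) ≤
        (1 - ε₂) * ((∑ j ∈ J, (dB j k - 1 / n)) * (∑ i ∈ I, (dC k i - 1 / n))) / n := by
      rw [hsumJ, hsumI, hsumΨ]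
      exact hdep
    exact hubMass_lt_of_noWin_depleted hn B hB hTPP hS0 hT0 hU0 dA dB dC hdA hdB hdC k J I β₀ γ₀
      ε₂ h₁ hβ hγ hε₂ hε₂1 hh₁ (fun j hj => (hflJ j hj).2.2.1) (fun i hi => (hflI i hi).2.2.1)
      hdep' hN1
  · -- (5) no small-area hub win
    exact subLevelAtom_penalty_of_noWin_hubArea hn B hB hTPP hS0 hT0 hU0 dA dB dC pB pC hdA hdB hdC
      θB θC hθB hθC hpB hpC M h₁ A₀ hM0 hh₁ k J I a.val b.val hJl hIl (σ a) (ρ b) (Ψ a b) (x a)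
      (y b) hσa hxa hρb hyb hΨab hhub harea hN2

/-- **Far-area penalty, masked (HA1-far).** Under the same hypotheses: a substantial atom of hub mass `≥ h₁` and area `≤ A₁` is strongly anti-depleted, `(n-1)(σρ/n - Ψ) ≤ -(M/2) σ ρ` — the no-win consequence of `volume_le_of_hub_atom_of_area` at area `A₁` (the `A₁`-term of `hW`), proved as conclusion (5) of `atom_noWin_facts` with `A₀` replaced by `A₁`. [folklore] -/
theorem atom_farArea_penalty_masked {n : ℕ} (hn : 2 ≤ n) (B : ℕ) (hB : ∀ S' T' U' : Finset (Equiv.Perm (Fin (n - 1))), TripleProductProperty S' T' U' → S'.card * T'.card * U'.card ≤ B) {S T U : Finset (Equiv.Perm (Fin n))} (hTPP : TripleProductProperty S T U) (hS0 : S.Nonempty) (hT0 : T.Nonempty) (hU0 : U.Nonempty) (dA dB dC pB pC : Fin n → Fin n → ℝ) (hdA : ∀ i j, dA i j = (((S ×ˢ T).filter fun st => st.2 j = st.1 i).card : ℝ) / (S.card * T.card : ℕ)) (hdB : ∀ j k, dB j k = (((T ×ˢ U).filter fun tu => tu.2 k = tu.1 j).card : ℝ) / (T.card * U.card : ℕ))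 (hdC : ∀ k i, dC k i = (((U ×ˢ S).filter fun us => us.2 i = us.1 k).card : ℝ) / (U.card * S.card : ℕ)) (θB θC : ℝ) (hθB : 16 / (n : ℝ) ≤ θB) (hθC : 16 / (n : ℝ) ≤ θC) (hpB : ∀ j k, pB j k = if θB ≤ dB j k then dB j k - 1 / n else 0) (hpC : ∀ k i, pC k i = if θC ≤ dC k i then dC k i - 1 / n else 0) (ε₁ ε₂ h₁ M A₀ P W A₁ : ℝ) (hε₁ : 0 < ε₁) (hε₂ : 0 < ε₂) (hε₂1 : ε₂ ≤ 1) (hh₁ : 0 < h₁) (hP0 : 0 ≤ P) (hM : 56 * (((⌊Real.logb 2 ((n : ℝ) ^ 2)⌋₊ + 1 : ℕ) : ℝ) * ((⌊Real.logb 2 ((n : ℝ) ^ 2)⌋₊ + 1 : ℕ) : ℝ)) ≤ M) (hA₀ : 5000 * n * (1 + Real.log n) * Real.log (4 * ((n.factorial : ℝ) / (S.card * T.card : ℕ)) / ε₂) / ε₂ ^ 2 ≤ A₀) (hA₀n : (n : ℝ) ≤ A₀) (hPlow : A₀ ^ 2 * (n : ℝ) ^ (-(151 / 100 : ℝ)) ≤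 P * ε₁ ^ 2) (hW : 10 ^ 7 * (1 + Real.log n) ^ 2 * (Real.log (4 * ((n.factorial : ℝ) / (S.card * T.card : ℕ)) / ε₂)) ^ 2 * n * B / (ε₂ ^ 4 * h₁ ^ 2) + 20 * (1 + M) * A₀ ^ 2 * B / (h₁ ^ 2 * n) + n * P * B + 20 * (1 + M) * A₁ ^ 2 * B / (h₁ ^ 2 * n) ≤ W) (hN : W < ((S.card * T.card * U.card : ℕ) : ℝ)) (k : Fin n) (Qm : Finset (Fin n)) (σ σ' x ρ ρ' y : Fin (⌊Real.logb 2 ((n : ℝ) ^ 2)⌋₊ + 1) → ℝ) (hσ : ∀ a, σ a = ∑ j ∈ Finset.univ.filter (fun j => θB ≤ dB j k ∧ ⌊Real.logb 2 (1 / dB j k)⌋₊ = a.val), pB j k) (hσ' : ∀ a, σ' a = ∑ j ∈ Finset.univ.filter (fun j => θB ≤ dB j k ∧ ⌊Real.logb 2 (1 / dB j k)⌋₊ = a.val), dB j k) (hx : ∀ a, x a = max (((Finset.univ.filter (fun j => θB ≤ dB j k ∧ ⌊Real.logb 2 (1 / dB j k)⌋₊ = a.val)).card : ℝ)) 1) (hρ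 : ∀ b, ρ b = ∑ i ∈ Finset.univ.filter (fun i => i ∉ Qm ∧ θC ≤ dC k i ∧ ⌊Real.logb 2 (1 / dC k i)⌋₊ = b.val), pC k i) (hρ' : ∀ b, ρ' b = ∑ i ∈ Finset.univ.filter (fun i => i ∉ Qm ∧ θC ≤ dC k i ∧ ⌊Real.logb 2 (1 / dC k i)⌋₊ = b.val), dC k i) (hy : ∀ b, y b = max (((Finset.univ.filter (fun i => i ∉ Qm ∧ θC ≤ dC k i ∧ ⌊Real.logb 2 (1 / dC k i)⌋₊ = b.val)).card : ℝ)) 1) (Ψ : Fin (⌊Real.logb 2 ((n : ℝ) ^ 2)⌋₊ + 1) → Fin (⌊Real.logb 2 ((n : ℝ) ^ 2)⌋₊ + 1) → ℝ) (hΨ : ∀ a b, Ψ a b = ∑ i ∈ Finset.univ.filter (fun i => i ∉ Qm ∧ θC ≤ dC k i ∧ ⌊Real.logb 2 (1 / dC k i)⌋₊ = b.val), ∑ j ∈ Finset.univ.filter (fun j => θB ≤ dB j k ∧ ⌊Real.logb 2 (1 / dB j k)⌋₊ = a.val), dA i j * pB j k * pC k i) (a b : Fin (⌊Real.logb 2 ((n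 : ℝ) ^ 2)⌋₊ + 1)) : (h₁ ≤ ∑ v : Fin n, ((U.filter fun u => u k = v).card : ℝ) / U.card * ((((T.filter fun t => t⁻¹ v ∈ Finset.univ.filter (fun j => θB ≤ dB j k ∧ ⌊Real.logb 2 (1 / dB j k)⌋₊ = a.val)).card : ℝ) / T.card) * (((S.filter fun s => s⁻¹ v ∈ Finset.univ.filter (fun i => i ∉ Qm ∧ θC ≤ dC k i ∧ ⌊Real.logb 2 (1 / dC k i)⌋₊ = b.val)).card : ℝ) / S.card)) → x a * y b ≤ A₁ → ((n : ℝ) - 1) * (σ a * ρ b / n - Ψ a b) ≤ -(M / 2) * σ a * ρ b) := by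
  -- hypotheses of the shared signature not needed here
  have _h : _ ∧ _ ∧ _ ∧ _ ∧ _ ∧ _ ∧ _ ∧ _ := ⟨hε₁, hε₂, hε₂1, hA₀, hA₀n, hPlow, hσ', hρ'⟩
  have hn0 : 0 < n := by omega
  -- the four win bounds are nonnegative, hence the fourth is exceeded by `N`
  have hM0 : 0 ≤ M := le_trans (by positivity) hM
  have hW1 : 0 ≤ 10 ^ 7 * (1 + Real.log n) ^ 2 *
      (Real.log (4 * ((n.factorial : ℝ) / (S.card * T.card : ℕ)) / ε₂)) ^ 2 * n * B /
        (ε₂ ^ 4 * h₁ ^ 2) := by positivity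
  have h1M : 0 ≤ 1 + M := by linarith
  have hW2 : 0 ≤ 20 * (1 + M) * A₀ ^ 2 * B / (h₁ ^ 2 * n) := by positivity
  have hW3 : 0 ≤ (n : ℝ) * P * B := by positivity
  have hN4 : 20 * (1 + M) * A₁ ^ 2 * B / (h₁ ^ 2 * n) < ((S.card * T.card * U.card : ℕ) : ℝ) := by
    linarith
  intro hhub harea
  exact subLevelAtom_penalty_of_noWin_hubArea hn B hB hTPP hS0 hT0 hU0 dA dB dC pB pC hdA hdB hdC
    θB θC hθB hθC hpB hpC M h₁ A₁ hM0 hh₁ k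
    (Finset.univ.filter (fun j => θB ≤ dB j k ∧ ⌊Real.logb 2 (1 / dB j k)⌋₊ = a.val))
    (Finset.univ.filter (fun i => i ∉ Qm ∧ θC ≤ dC k i ∧ ⌊Real.logb 2 (1 / dC k i)⌋₊ = b.val))
    a.val b.val (fun j hj => (Finset.mem_filter.1 hj).2) (fun i hi => (Finset.mem_filter.1 hi).2.2)
    (σ a) (ρ b) (Ψ a b) (x a) (y b) (hσ a) (hx a) (hρ b) (hy b) (hΨ a b) hhub harea hN4

/-- **Rate box of the included levels, masked (HA1b-m).** As `incl_rate_bounds` for the masked S-blocks: the levels of depleted substantial pairs have `log x, log y ∈ [0.245, 0.755] · log n`. [folklore] -/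
theorem incl_rate_bounds_masked {n : ℕ} (hn : 2 ≤ n) (B : ℕ) (hB : ∀ S' T' U' : Finset (Equiv.Perm (Fin (n - 1))), TripleProductProperty S' T' U' → S'.card * T'.card * U'.card ≤ B) {S T U : Finset (Equiv.Perm (Fin n))} (hTPP : TripleProductProperty S T U) (hS0 : S.Nonempty) (hT0 : T.Nonempty) (hU0 : U.Nonempty) (dA dB dC pB pC : Fin n → Fin n → ℝ) (hdA : ∀ i j, dA i j = (((S ×ˢ T).filter fun st => st.2 j = st.1 i).card : ℝ) / (S.card * T.card : ℕ)) (hdB : ∀ j k, dB j k = (((T ×ˢ U).filter fun tu => tu.2 k = tu.1 j).card : ℝ) / (T.card * U.card : ℕ)) (hdC : ∀ k i, dC k i = (((U ×ˢ S).filter fun us => us.2 i = us.1 k).card : ℝ) / (U.card * S.card : ℕ)) (θB θC : ℝ) (hθB : 16 / (n : ℝ) ≤ θB) (hθC : 16 / (n : ℝ) ≤ θC) (hpB : ∀ j k, pB j k = if θB ≤ dB j k then dB j k - 1 / n else 0) (hpC : ∀ k i, pC k i = if θC ≤ dC k i then dC k i - 1 / n else 0) (ε₁ ε₂ h₁ M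 A₀ P W A₁ : ℝ) (hε₁ : 0 < ε₁) (hε₂ : 0 < ε₂) (hε₂1 : ε₂ ≤ 1) (hh₁ : 0 < h₁) (hP0 : 0 ≤ P) (hM : 56 * (((⌊Real.logb 2 ((n : ℝ) ^ 2)⌋₊ + 1 : ℕ) : ℝ) * ((⌊Real.logb 2 ((n : ℝ) ^ 2)⌋₊ + 1 : ℕ) : ℝ)) ≤ M) (hA₀ : 5000 * n * (1 + Real.log n) * Real.log (4 * ((n.factorial : ℝ) / (S.card * T.card : ℕ)) / ε₂) / ε₂ ^ 2 ≤ A₀) (hA₀n : (n : ℝ) ≤ A₀) (hA₀log : Real.log A₀ ≤ 101 / 100 * Real.log n) (hPlow : A₀ ^ 2 * (n : ℝ) ^ (-(151 / 100 : ℝ)) ≤ P * ε₁ ^ 2) (hW : 10 ^ 7 * (1 + Real.log n) ^ 2 * (Real.log (4 * ((n.factorial : ℝ) / (S.card * T.card : ℕ)) / ε₂)) ^ 2 * n * B / (ε₂ ^ 4 * h₁ ^ 2) + 20 * (1 + M) * A₀ ^ 2 * B / (h₁ ^ 2 * n) + n * P * B + 20 * (1 + M) * A₁ ^ 2 * B /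 (h₁ ^ 2 * n) ≤ W) (hN : W < ((S.card * T.card * U.card : ℕ) : ℝ)) (k : Fin n) (Qm : Finset (Fin n)) (σ σ' x ρ ρ' y : Fin (⌊Real.logb 2 ((n : ℝ) ^ 2)⌋₊ + 1) → ℝ) (hσ : ∀ a, σ a = ∑ j ∈ Finset.univ.filter (fun j => θB ≤ dB j k ∧ ⌊Real.logb 2 (1 / dB j k)⌋₊ = a.val), pB j k) (hσ' : ∀ a, σ' a = ∑ j ∈ Finset.univ.filter (fun j => θB ≤ dB j k ∧ ⌊Real.logb 2 (1 / dB j k)⌋₊ = a.val), dB j k) (hx : ∀ a, x a = max (((Finset.univ.filter (fun j => θB ≤ dB j k ∧ ⌊Real.logb 2 (1 / dB j k)⌋₊ = a.val)).card : ℝ)) 1) (hρ : ∀ b, ρ b = ∑ i ∈ Finset.univ.filter (fun i => i ∉ Qm ∧ θC ≤ dC k i ∧ ⌊Real.logb 2 (1 / dC k i)⌋₊ = b.val), pC k i) (hρ' : ∀ b, ρ' b = ∑ i ∈ Finset.univ.filter (fun i => i ∉ Qm ∧ θC ≤ dC k i ∧ ⌊Real.logb 2 (1 / dC k i)⌋₊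 = b.val), dC k i) (hy : ∀ b, y b = max (((Finset.univ.filter (fun i => i ∉ Qm ∧ θC ≤ dC k i ∧ ⌊Real.logb 2 (1 / dC k i)⌋₊ = b.val)).card : ℝ)) 1) (Ψ : Fin (⌊Real.logb 2 ((n : ℝ) ^ 2)⌋₊ + 1) → Fin (⌊Real.logb 2 ((n : ℝ) ^ 2)⌋₊ + 1) → ℝ) (hΨ : ∀ a b, Ψ a b = ∑ i ∈ Finset.univ.filter (fun i => i ∉ Qm ∧ θC ≤ dC k i ∧ ⌊Real.logb 2 (1 / dC k i)⌋₊ = b.val), ∑ j ∈ Finset.univ.filter (fun j => θB ≤ dB j k ∧ ⌊Real.logb 2 (1 / dB j k)⌋₊ = a.val), dA i j * pB j k * pC k i) : (∀ a, (ε₁ ≤ σ a ∧ ∃ b, ε₁ ≤ ρ b ∧ Ψ a b ≤ (1 - ε₂) * (σ a * ρ b) / n) → 245 / 1000 * Real.log n ≤ Real.log (x a) ∧ Real.log (x a) ≤ 755 / 1000 * Real.log n) ∧ (∀ b, (ε₁ ≤ ρ b ∧ ∃ a, ε₁ ≤ σ a ∧ Ψ a b ≤ (1 - ε₂) * (σ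 a * ρ b) / n) → 245 / 1000 * Real.log n ≤ Real.log (y b) ∧ Real.log (y b) ≤ 755 / 1000 * Real.log n) := by
  have _h := hA₀log
  have hAF := fun a b => atom_noWin_facts_masked hn B hB hTPP hS0 hT0 hU0 dA dB dC pB pC hdA hdB hdC
    θB θC hθB hθC hpB hpC ε₁ ε₂ h₁ M A₀ P W A₁ hε₁ hε₂ hε₂1 hh₁ hP0 hM hA₀ hA₀n hPlow hW hN k Qm σ σ'
    x ρ ρ' y hσ hσ' hx hρ hρ' hy Ψ hΨ a b
  have hx1 : ∀ a, 1 ≤ x a := fun a => by rw [hx]; exact le_max_right _ _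
  have hy1 : ∀ b, 1 ≤ y b := fun b => by rw [hy]; exact le_max_right _ _
  refine ⟨fun a ⟨ha, b, hb, hdep⟩ => ?_, fun b ⟨hb, a, ha, hdep⟩ => ?_⟩
  · obtain ⟨h1, h2, h3, -, -⟩ := hAF a b
    exact rate_box hn hA₀n (hx1 a) (hy1 b) (h1 ha) (h2 hb) (h3 hdep)
  · obtain ⟨h1, h2, h3, -, -⟩ := hAF a b
    exact rate_box hn hA₀n (hy1 b) (hx1 a) (h2 hb) (h1 ha) ((mul_comm _ _).trans_le (h3 hdep))

end Summit.MatrixMultiplication.MatrixMultiplication.Theorems.PolynomialSlack
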